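import Mathlib

/-!
# Transport (holonomy) vertices: the second-order background-field expansion of an ordered product of
# exponentials, with remainder bounds UNIFORM IN THE NUMBER OF FACTORS

Topic `MathematicalPhysics/QuantumFieldTheory/Balaban1983to89/Beta`; namespace
`Literature.MathematicalPhysics.QuantumFieldTheory.Balaban1983to89.Beta.TransportVertices`.
Companion of `Beta/BackgroundVertices` (the vertices of the covariant lattice difference).  Everything here is
PROVED elementary analysis in a complete normed algebra `𝔸` over `𝕜 = ℝ` or `ℂ` (no hypothesis `‖1‖ = 1`);
nothing is asserted about Bałaban's operators — the file supplies kernel-checked forms of the two Taylor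
expansions his background-field calculus uses for PRODUCTS of link variables, and the reason their vertex
kernels are uniform in the renormalisation step.

WHAT IS IN PRINT (context, cited by number; the manuscripts are the object of the audit and are not used as facts).
T. Bałaban, *Propagators for lattice gauge theories in a background field*, Commun. Math. Phys. 99 (1985)
389–434 [Balaban1985BackgroundPropagators], pp. 390–391: (3.1) `A^η(U′U₀) = Σ_{p⊂T_η} η^{d−4}[1 − Re tr(U′U₀)(∂p)]`,
`tr(U′U₀)(∂p) = tr(∂₀U′)((p)_z)U₀(∂p)`; (3.2) the expansion of the plaquette variable in the transported fields
`A′(b)`, `b ⊂ ∂(p)_z`, whose second-order term is printed, in the final form of the display, as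
«− ½η[Σ_{b⊂∂(p)_z} (A′(b))² + 2 Σ_{b₁,b₂⊂∂(p)_z, b₁≺b₂} A′(b₁)A′(b₂)]» [sic: `η` to the FIRST power in this line of the
print; the unexpanded line above it reads «− ½η²[(R(U₀(x,w))A(z,w))² + 2R(U₀(x,w))A(z,w)A(w,x) + ⋯]» and
`U′ = exp iηA` forces `η²` — a display misprint, immaterial here] («≺ denotes a natural ordering among bonds of the
oriented contour»); the covariant difference «(D^η_{U₀}A)(b) = η⁻¹(R(U₀(b))A(b₊) − A(b₋))» (unnumbered display at the
foot of p. 390) with (3.3) `(D^η_{U₀,μ}A)(x) = (D^η_{U₀}A)(x, x + ηe_μ)`; (3.4) the plaquette derivative with parallel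
transports `(D^η_{U₀}A)(p) = η⁻¹(A(x,y) + R(U₀(x,y))A(y,z) + R(U₀(x,w))A(z,w) + A(w,x))`; (3.5) the orientation
conventions `U(x,x′) = U⁻¹(x′,x)`, `A(x,x′) = −A(x′,x)`; and (3.6) the same expansion rewritten:
«(∂₀U′)((p)_z) = 1 + iη²(D^η_{U₀}A)(p) − ½η⁴((D^η_{U₀}A)(p))² + iη² Σ_{b₁,b₂⊂∂(p)_z, b₁≺b₂} i[A′(b₁), A′(b₂)] + ⋯»,
inserted into the Wilson action in (3.7) to DEFINE the fine Hessian `Δ^η(U₀)`; «This expansion is valid also for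
configurations A and U₀ with values respectively in the complexified algebra g^c and the group G^c».
T. Bałaban, *Renormalization group approach to lattice gauge field theories. I*, Commun. Math. Phys. 109 (1987)
249–301 [Balaban1987RG1], p. 263: the inductive analyticity/size hypothesis (1.18) on the effective-action terms
and (1.19) «This assumption is an easily verifiable statement for all explicitly defined terms in the action
(1.3)» — the verification is not carried out in print; the averaging operations of the k-th step transport
fields along contours of the fine lattice `T_η`, `η = L^{−k}`, lying in unit cubes.

WHAT THIS FILE PROVES.  For a list `l = [b₁, …, b_n]` in `𝔸` put `holonomy l = exp b₁ ⋯ exp b_n` (ordered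
product), `size l = Σ_j ‖b_j‖`, `quad 𝕜 l = Σ_{i<j} b_i b_j + ½ Σ_j b_j²` (the second-order term of the ordered
product) and `commSum l = Σ_{i<j} (b_i b_j − b_j b_i)`.
* §0 `expTail m x = e^x − Σ_{n<m} xⁿ/n!` (real Taylor tails): series representation, monotonicity, the addition
  formulas `expTail_one_add`, `expTail_two_add`, `expTail_three_add` that drive the induction, and
  `expTail_three_le : expTail 3 x ≤ x³ e^x / 6`; in `𝔸`: `norm_exp_sub_taylor_le`
  (`‖exp a − Σ_{n<m} aⁿ/n!‖ ≤ expTail m ‖a‖`, `m ≥ 1`) and its cases `m = 1, 2, 3`, `norm_exp_mul_le`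
  (`‖exp b · R‖ ≤ e^{‖b‖} ‖R‖` without `‖1‖ = 1`).
* §1 ORDERED PRODUCTS: `norm_holonomy_sub_one_le : ‖holonomy l − 1‖ ≤ e^s − 1`,
  `norm_holonomy_sub_taylor_one_le : ‖holonomy l − 1 − Σ b_j‖ ≤ e^s − 1 − s`,
  `norm_holonomy_sub_taylor_two_le : ‖holonomy l − 1 − Σ b_j − quad l‖ ≤ e^s − 1 − s − s²/2 ≤ s³ e^s / 6`,
  `s = size l` — EXACT telescoping, no combinatorial constants, no dependence on `n` except through `s`;
  `two_smul_quad : 2·quad l = (Σ b_j)² + commSum l` (the shape of the second-order term in (3.6): half the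
  square of the sum plus half the sum of ordered commutators), `two_smul_quad_eq_sqSum_add :
  2·quad l = Σ b_j² + 2 Σ_{i<j} b_i b_j` (the bracket printed in (3.2)) and `sqSum_add_two_smul_pairSum :
  Σ b_j² + 2 Σ_{i<j} b_i b_j = (Σ b_j)² + Σ_{i<j}[b_i, b_j]` (the passage (3.2) → (3.6)) [v1.1], `norm_quad_le`,
  `norm_commSum_le`, `commSum_four` (the plaquette, `n = 4`).
* §2 SCALING = k-UNIFORMITY: for `b_j = η • a_j` with `‖a_j‖ ≤ a` and `‖η‖ · n ≤ ℓ` (a contour of `n` bonds of the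
  `η`-lattice of PHYSICAL length `≤ ℓ`), `norm_holonomy_smul_sub_taylor_two_le`:
  `‖Π_j exp(η a_j) − 1 − η Σ a_j − η² quad(a)‖ ≤ expTail 3 (ℓ a) ≤ (ℓa)³ e^{ℓa} / 6` — a bound in which the number
  of factors `n = O(η⁻¹) = O(L^k)` does not appear: the first- and second-order transport vertices
  (`η Σ_j a_j`, a Riemann sum along the contour, and `η² quad`) have kernels bounded by `ℓ`, `ℓ²/2` per unit
  sup-norm of the field, and the Taylor remainder is third order, uniformly in `k`.
* §3 THE VERTICES AS DERIVATIVES: for the path `t ↦ holPath l t = Π_j exp(t b_j)`, `hasDerivAt_holPath`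
  (derivative `D₁ l t`), `hasDerivAt_D₁` (derivative `D₂ l t`), `D₁_zero : D₁ l 0 = Σ b_j`,
  `D₂_zero : D₂ l 0 = (Σ b_j)² + commSum l = 2·quad l` — the first and second variations of a transport at
  zero background, i.e. the objects whose kernels §1–§2 bound.

NOTE ON THE COEFFICIENT OF THE COMMUTATOR TERM IN (3.6) [v1.1; audit record GAPS G-an2-16 of the β sub-cell].  With
`b_j = iηA′(b_j)` the kernel identities give for the second-order term of `(∂₀U′)((p)_z) = Π_j exp b_j`:
`quad = ½(Σ_j b_j)² + ½ Σ_{i<j}[b_i, b_j] = −½η⁴((D^η_{U₀}A)(p))² + ½·iη² Σ_{b₁≺b₂} i[A′(b₁), A′(b₂)]`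
(using `Σ_j b_j = iη Σ_b A′(b) = iη²(D^η_{U₀}A)(p)` by (3.4)) — this is (3.2) as printed, via
`sqSum_add_two_smul_pairSum`; the display (3.6) prints the last term as «+ iη² Σ_{b₁≺b₂} i[A′(b₁), A′(b₂)]», i.e.
WITHOUT the factor ½.  Inserting the expansion into (3.1) (`Re tr(XU₀) = tr(X Re U₀)` for hermitian `X`,
`Re tr(CU₀) = tr(iC · Im U₀)` for anti-hermitian `C`) gives exactly the printed (3.7),
«+ ½ Σ_p η^d [tr((D^η_{U₀}A)(p))² Re U₀(∂p) + tr Σ_{b₁≺b₂} i[A′(b₁), A′(b₂)] η⁻² Im U₀(∂p)]», and hence (3.10), ONLY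
with the coefficient ½; so (3.7), (3.10), (3.12) are consistent with (3.2) and with this file, and the missing ½ in
(3.6) is an isolated misprint that does not propagate (the paper uses `Δ′` only as a small bounded perturbation of
`D*D`, p. 392; a reader taking the spin vertex from (3.6) rather than (3.10) would double it).  This remark audits a
display; it asserts nothing about the paper's theorems.

HOW IT IS MEANT TO BE USED (remark).  With `Beta/BackgroundVertices` (vertices `V₁`, `K₂form` of the covariant
difference, gauge covariance) this covers the pointwise, `η`-explicit part of the second-order background-field
expansion of the local terms of Bałaban's fine action and averaging operators — item (L2-b)(β) «transport /
plaquette vertices» of the β sub-cell notes HOME/BETA/AN2.md §10 (steps (N1), (N2)).  It does NOT give: the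
localized analytic norms of [Balaban1987RG1] (1.18), any statement about the propagators `G(U₀)`, `𝓗(U₀)` or the
minimizers, or any composition with propagators (step (N3)); those remain open there.  Discharging the
sub-cell's target would make Bałaban's ultraviolet stability unconditional — a constructive-QFT statement; it is
NOT the continuum limit and NOT the Clay problem, and this file is not progress on either.

References: T. Bałaban, Commun. Math. Phys. 99 (1985) 389–434 [Balaban1985BackgroundPropagators] ((3.2)–(3.7),
pp. 390–391); T. Bałaban, Commun. Math. Phys. 109 (1987) 249–301 [Balaban1987RG1] ((1.18)–(1.19), p. 263);
for the elementary estimates: E. Hille, R. S. Phillips, *Functional Analysis and Semi-Groups* (AMS 1957) Ch. V;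
M. Reed, B. Simon, *Methods of Modern Mathematical Physics I* §VIII.8 (Trotter-product-type telescoping).
Unit `b2b-balaban-beta-an2-g3` (BETA cell, row an2, gen 3); v1 p180455; v1.1 (same seat, additive: `sqSum`, `pairSum`,
`two_smul_quad_eq_sqSum_add`, `sqSum_add_two_smul_pairSum`, the NOTE on (3.6); no v1 declaration changed); v1.1.1
DOCFIX (this docstring only, no declaration touched; answers the outside-lineage cross-reads of v1/v1.1 recorded in the
cell's GAPS C-beta-83 and C-an1-15): the (3.2) quotation now reproduces the printed «− ½η[» of the final form [sic],
the (3.6) quotation's glyphs `(p)_z` / `∂(p)_z` are restored, and the locators of (3.3)–(3.5) are stated item by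
item; staged byte-identically under `HOME/lean/BalabanYm4/`.  NOT summit progress.
-/

noncomputable section

open NormedSpace

namespace Literature.MathematicalPhysics.QuantumFieldTheory.Balaban1983to89.Beta.TransportVertices

/-! ## §0  Taylor tails of the exponential -/

section RealTail

open Nat

/-- The `m`-th Taylor tail of the real exponential, `expTail m x = e^x − Σ_{n<m} xⁿ/n!`. [folklore] -/
def expTail (m : ℕ) (x : ℝ) : ℝ := Real.exp x - ∑ n ∈ Finset.range m, x ^ n / n !

/-- Series representation `expTail m x = Σ_{n ≥ 0} x^{n+m}/(n+m)!`. [folklore] -/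
theorem hasSum_expTail (m : ℕ) (x : ℝ) :
    HasSum (fun n : ℕ => x ^ (n + m) / (n + m)!) (expTail m x) := by
  have h2 : HasSum (fun n : ℕ => x ^ n / n !) (Real.exp x) := by
    rw [Real.exp_eq_exp_ℝ]
    exact expSeries_div_hasSum_exp x
  exact (hasSum_nat_add_iff' m).mpr h2

/-- `expTail 1 x = e^x − 1`. [folklore] -/
@[simp] theorem expTail_one (x : ℝ) : expTail 1 x = Real.exp x - 1 := by
  simp [expTail]

/-- `expTail 2 x = e^x − 1 − x`. [folklore] -/
@[simp] theorem expTail_two (x : ℝ) : expTail 2 x = Real.exp x - 1 - x := by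
  simp [expTail, Finset.sum_range_succ]
  ring

/-- `expTail 3 x = e^x − 1 − x − x²/2`. [folklore] -/
@[simp] theorem expTail_three (x : ℝ) : expTail 3 x = Real.exp x - 1 - x - x ^ 2 / 2 := by
  simp [expTail, Finset.sum_range_succ, Nat.factorial]
  ring

/-- Taylor tails of `e^x` are non-negative for `x ≥ 0`. [folklore] -/
theorem expTail_nonneg (m : ℕ) {x : ℝ} (hx : 0 ≤ x) : 0 ≤ expTail m x :=
  (hasSum_expTail m x).nonneg fun n => by positivity

/-- Taylor tails of `e^x` are monotone on `x ≥ 0`. [folklore] -/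
theorem expTail_mono (m : ℕ) {x y : ℝ} (hx : 0 ≤ x) (hxy : x ≤ y) : expTail m x ≤ expTail m y :=
  hasSum_le (fun n => by gcongr) (hasSum_expTail m x) (hasSum_expTail m y)

/-- Addition formula driving the zeroth-order induction: `e^{x+y} − 1 = e^x (e^y − 1) + (e^x − 1)`. [folklore] -/
theorem expTail_one_add (x y : ℝ) :
    expTail 1 (x + y) = Real.exp x * expTail 1 y + expTail 1 x := by
  simp only [expTail_one, Real.exp_add]
  ring

/-- Addition formula driving the first-order induction:
`e^{x+y} − 1 − (x+y) = e^x (e^y − 1 − y) + (e^x − 1 − x) + (e^x − 1) y`. [folklore] -/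
theorem expTail_two_add (x y : ℝ) :
    expTail 2 (x + y) = Real.exp x * expTail 2 y + expTail 2 x + expTail 1 x * y := by
  simp only [expTail_one, expTail_two, Real.exp_add]
  ring

/-- Addition formula driving the second-order induction: `T₃(x+y) = e^x T₃(y) + T₃(x) + T₂(x) y + T₁(x) y²/2`,
`T_m = expTail m`. [folklore] -/
theorem expTail_three_add (x y : ℝ) :
    expTail 3 (x + y) =
      Real.exp x * expTail 3 y + expTail 3 x + expTail 2 x * y + expTail 1 x * (y ^ 2 / 2) := by
  simp only [expTail_one, expTail_two, expTail_three, Real.exp_add]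
  ring

/-- `2 · n! ≤ (n+2)!`. [folklore] -/
theorem two_mul_factorial_le (n : ℕ) : 2 * n ! ≤ (n + 2)! := by
  calc 2 * n ! = 2 * (1 * n !) := by ring
    _ ≤ (n + 2) * ((n + 1) * n !) := by gcongr <;> omega
    _ = (n + 2)! := by simp [Nat.factorial_succ]

/-- `6 · n! ≤ (n+3)!`. [folklore] -/
theorem six_mul_factorial_le (n : ℕ) : 6 * n ! ≤ (n + 3)! := by
  calc 6 * n ! = 3 * (2 * (1 * n !)) := by ring
    _ ≤ (n + 3) * ((n + 2) * ((n + 1) * n !)) := by gcongr <;> omega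
    _ = (n + 3)! := by simp [Nat.factorial_succ]

/-- Second-order tail bound `e^x − 1 − x ≤ (x²/2) e^x` for `x ≥ 0`. [folklore] -/
theorem expTail_two_le {x : ℝ} (hx : 0 ≤ x) : expTail 2 x ≤ x ^ 2 / 2 * Real.exp x := by
  have h2 : HasSum (fun n : ℕ => x ^ 2 / 2 * (x ^ n / n !)) (x ^ 2 / 2 * Real.exp x) := by
    have h : HasSum (fun n : ℕ => x ^ n / n !) (Real.exp x) := by
      rw [Real.exp_eq_exp_ℝ]
      exact expSeries_div_hasSum_exp x
    exact h.mul_left _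
  refine hasSum_le (fun n => ?_) (hasSum_expTail 2 x) h2
  rw [pow_add, show x ^ 2 / 2 * (x ^ n / n !) = x ^ n * x ^ 2 / (2 * n !) by ring]
  gcongr
  exact_mod_cast two_mul_factorial_le n

/-- Third-order tail bound `e^x − 1 − x − x²/2 ≤ (x³/6) e^x` for `x ≥ 0`. [folklore] -/
theorem expTail_three_le {x : ℝ} (hx : 0 ≤ x) : expTail 3 x ≤ x ^ 3 / 6 * Real.exp x := by
  have h2 : HasSum (fun n : ℕ => x ^ 3 / 6 * (x ^ n / n !)) (x ^ 3 / 6 * Real.exp x) := by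
    have h : HasSum (fun n : ℕ => x ^ n / n !) (Real.exp x) := by
      rw [Real.exp_eq_exp_ℝ]
      exact expSeries_div_hasSum_exp x
    exact h.mul_left _
  refine hasSum_le (fun n => ?_) (hasSum_expTail 3 x) h2
  rw [pow_add, show x ^ 3 / 6 * (x ^ n / n !) = x ^ n * x ^ 3 / (6 * n !) by ring]
  gcongr
  exact_mod_cast six_mul_factorial_le n

end RealTail

section AlgebraTail

open Nat

variable (𝕜 : Type*) [RCLike 𝕜] {𝔸 : Type*} [NormedRing 𝔸] [NormedAlgebra 𝕜 𝔸] [CompleteSpace 𝔸]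

/-- Taylor tail of the exponential in a Banach algebra: `‖exp a − Σ_{n<m} aⁿ/n!‖ ≤ expTail m ‖a‖` for `m ≥ 1`
(termwise comparison with the real series; no hypothesis on `‖1‖`). [folklore] -/
theorem norm_exp_sub_taylor_le (a : 𝔸) {m : ℕ} (hm : 1 ≤ m) :
    ‖exp a - ∑ n ∈ Finset.range m, (n !⁻¹ : 𝕜) • a ^ n‖ ≤ expTail m ‖a‖ := by
  have h1 : HasSum (fun n => (n !⁻¹ : 𝕜) • a ^ n) (exp a) := exp_series_hasSum_exp' a
  have h1' := (hasSum_nat_add_iff' m).mpr h1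
  refine h1'.norm_le_of_bounded (hasSum_expTail m ‖a‖) fun n => ?_
  rw [norm_smul, norm_inv, RCLike.norm_natCast, div_eq_inv_mul]
  gcongr
  exact norm_pow_le' a (by omega)

include 𝕜 in
/-- Case `m = 1` in tail form: `‖exp a − 1‖ ≤ expTail 1 ‖a‖` (the shape consumed by the inductions of §1; the
unfolded inequality `‖exp a − 1‖ ≤ e^{‖a‖} − 1` over `ℝ` is the tree's
`Literature.Analysis.Calculus.norm_exp_sub_one_le`). [folklore] -/
theorem norm_exp_sub_one_le_expTail (a : 𝔸) : ‖exp a - 1‖ ≤ expTail 1 ‖a‖ := by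
  simpa using norm_exp_sub_taylor_le 𝕜 a (m := 1) le_rfl

include 𝕜 in
/-- Case `m = 2`: `‖exp a − 1 − a‖ ≤ expTail 2 ‖a‖ = e^{‖a‖} − 1 − ‖a‖`. [folklore] -/
theorem norm_exp_sub_one_sub_le_expTail (a : 𝔸) : ‖exp a - 1 - a‖ ≤ expTail 2 ‖a‖ := by
  have h := norm_exp_sub_taylor_le 𝕜 a (m := 2) (by norm_num)
  simpa [Finset.sum_range_succ, sub_sub, add_assoc] using h

/-- Case `m = 3`: `‖exp a − 1 − a − ½a²‖ ≤ expTail 3 ‖a‖ = e^{‖a‖} − 1 − ‖a‖ − ‖a‖²/2`. [folklore] -/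
theorem norm_exp_sub_taylor_two_le (a : 𝔸) :
    ‖exp a - 1 - a - (2 : 𝕜)⁻¹ • (a * a)‖ ≤ expTail 3 ‖a‖ := by
  have h := norm_exp_sub_taylor_le 𝕜 a (m := 3) (by norm_num)
  simpa [Finset.sum_range_succ, sub_sub, add_assoc, pow_two, Nat.factorial] using h

include 𝕜 in
/-- `‖exp b · R‖ ≤ e^{‖b‖} ‖R‖` without assuming `‖1‖ = 1` (write `exp b · R = (exp b − 1) R + R`). [folklore] -/
theorem norm_exp_mul_le (b R : 𝔸) : ‖exp b * R‖ ≤ Real.exp ‖b‖ * ‖R‖ := by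
  have h : exp b * R = (exp b - 1) * R + R := by noncomm_ring
  have h1 : ‖exp b - 1‖ ≤ Real.exp ‖b‖ - 1 := by simpa using norm_exp_sub_one_le_expTail 𝕜 b
  calc ‖exp b * R‖ = ‖(exp b - 1) * R + R‖ := by rw [h]
    _ ≤ ‖exp b - 1‖ * ‖R‖ + ‖R‖ := (norm_add_le _ _).trans (by gcongr; exact norm_mul_le _ _)
    _ ≤ (Real.exp ‖b‖ - 1) * ‖R‖ + ‖R‖ := by gcongr
    _ = Real.exp ‖b‖ * ‖R‖ := by ring

end AlgebraTail

/-! ## §1  Ordered products of exponentials -/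

section Holonomy

variable (𝕜 : Type*) [RCLike 𝕜] {𝔸 : Type*} [NormedRing 𝔸] [NormedAlgebra 𝕜 𝔸] [CompleteSpace 𝔸]

/-- The ordered product `holonomy [b₁, …, b_n] = exp b₁ · exp b₂ ⋯ exp b_n` (parallel transport along a
contour whose bonds carry the link variables `exp b_j`). [folklore] -/
def holonomy (l : List 𝔸) : 𝔸 := (l.map exp).prod

omit [NormedAlgebra 𝕜 𝔸] [CompleteSpace 𝔸] in
/-- `holonomy [] = 1`. [folklore] -/
@[simp] theorem holonomy_nil : holonomy ([] : List 𝔸) = 1 := by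
  simp [holonomy]

omit [NormedAlgebra 𝕜 𝔸] [CompleteSpace 𝔸] in
/-- `holonomy (b :: l) = exp b · holonomy l`. [folklore] -/
@[simp] theorem holonomy_cons (b : 𝔸) (l : List 𝔸) : holonomy (b :: l) = exp b * holonomy l := by
  simp [holonomy]

/-- The size `size l = Σ_j ‖b_j‖` of a list. [folklore] -/
def size (l : List 𝔸) : ℝ := (l.map (‖·‖)).sum

omit [NormedAlgebra 𝕜 𝔸] [CompleteSpace 𝔸] in
/-- `size [] = 0`. [folklore] -/
@[simp] theorem size_nil : size ([] : List 𝔸) = 0 := by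
  simp [size]

omit [NormedAlgebra 𝕜 𝔸] [CompleteSpace 𝔸] in
/-- `size (b :: l) = ‖b‖ + size l`. [folklore] -/
@[simp] theorem size_cons (b : 𝔸) (l : List 𝔸) : size (b :: l) = ‖b‖ + size l := by
  simp [size]

omit [NormedAlgebra 𝕜 𝔸] [CompleteSpace 𝔸] in
/-- `0 ≤ size l`. [folklore] -/
theorem size_nonneg (l : List 𝔸) : 0 ≤ size l := by
  induction l with
  | nil => simp
  | cons b l ih => rw [size_cons]; positivity

omit [NormedAlgebra 𝕜 𝔸] [CompleteSpace 𝔸] in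
/-- `‖Σ_j b_j‖ ≤ size l`. [folklore] -/
theorem norm_sum_le_size (l : List 𝔸) : ‖l.sum‖ ≤ size l := by
  induction l with
  | nil => simp
  | cons b l ih =>
    rw [List.sum_cons, size_cons]
    exact (norm_add_le _ _).trans (by gcongr)

omit [NormedAlgebra 𝕜 𝔸] [CompleteSpace 𝔸] in
/-- `size l ≤ n · a` if the `n` entries have norm `≤ a`. [folklore] -/
theorem size_le_length_mul (l : List 𝔸) {a : ℝ} (ha : ∀ b ∈ l, ‖b‖ ≤ a) : size l ≤ l.length * a := by
  induction l with
  | nil => simp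
  | cons b l ih =>
    rw [size_cons, List.length_cons, Nat.cast_succ]
    have hb : ‖b‖ ≤ a := ha b (by simp)
    have hl : size l ≤ l.length * a := ih fun c hc => ha c (by simp [hc])
    linarith

/-- The second-order term of the ordered product: `quad [b₁, …, b_n] = Σ_{i<j} b_i b_j + ½ Σ_j b_j²`
(recursively, `quad (b :: l) = quad l + b · Σ l + ½ b²`). [folklore] -/
def quad : List 𝔸 → 𝔸
  | [] => 0
  | b :: l => quad l + b * l.sum + (2 : 𝕜)⁻¹ • (b * b)

omit [CompleteSpace 𝔸] in
/-- `quad [] = 0`. [folklore] -/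
@[simp] theorem quad_nil : quad 𝕜 ([] : List 𝔸) = 0 := rfl

omit [CompleteSpace 𝔸] in
/-- `quad (b :: l) = quad l + b · Σ l + ½ b²`. [folklore] -/
@[simp] theorem quad_cons (b : 𝔸) (l : List 𝔸) :
    quad 𝕜 (b :: l) = quad 𝕜 l + b * l.sum + (2 : 𝕜)⁻¹ • (b * b) := rfl

/-- The sum of ordered commutators `commSum [b₁, …, b_n] = Σ_{i<j} (b_i b_j − b_j b_i)` (recursively,
`commSum (b :: l) = commSum l + (b · Σ l − Σ l · b)`) — the term `Σ_{b₁≺b₂} [A′(b₁), A′(b₂)]` of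
[Balaban1985BackgroundPropagators] (3.6). [folklore] -/
def commSum : List 𝔸 → 𝔸
  | [] => 0
  | b :: l => commSum l + (b * l.sum - l.sum * b)

omit [NormedAlgebra 𝕜 𝔸] [CompleteSpace 𝔸] in
/-- `commSum [] = 0`. [folklore] -/
@[simp] theorem commSum_nil : commSum ([] : List 𝔸) = 0 := rfl

omit [NormedAlgebra 𝕜 𝔸] [CompleteSpace 𝔸] in
/-- `commSum (b :: l) = commSum l + (b · Σ l − Σ l · b)`. [folklore] -/
@[simp] theorem commSum_cons (b : 𝔸) (l : List 𝔸) :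
    commSum (b :: l) = commSum l + (b * l.sum - l.sum * b) := rfl

omit [NormedAlgebra 𝕜 𝔸] [CompleteSpace 𝔸] in
/-- The plaquette case `n = 4`: `commSum [b₁, b₂, b₃, b₄]` is the sum of the six ordered commutators
`[b_i, b_j]`, `i < j` (the term of [Balaban1985BackgroundPropagators] (3.6)). [folklore] -/
theorem commSum_four (b₁ b₂ b₃ b₄ : 𝔸) :
    commSum [b₁, b₂, b₃, b₄] =
      (b₁ * b₂ - b₂ * b₁) + (b₁ * b₃ - b₃ * b₁) + (b₁ * b₄ - b₄ * b₁) +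
      (b₂ * b₃ - b₃ * b₂) + (b₂ * b₄ - b₄ * b₂) + (b₃ * b₄ - b₄ * b₃) := by
  simp only [commSum_cons, commSum_nil, List.sum_cons, List.sum_nil]
  noncomm_ring

omit [NormedAlgebra 𝕜 𝔸] [CompleteSpace 𝔸] in
/-- The sum of squares `sqSum [b₁, …, b_n] = Σ_j b_j²`. [folklore] -/
def sqSum : List 𝔸 → 𝔸
  | [] => 0
  | b :: l => b * b + sqSum l

omit [NormedAlgebra 𝕜 𝔸] [CompleteSpace 𝔸] in
/-- `sqSum [] = 0`. [folklore] -/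
@[simp] theorem sqSum_nil : sqSum ([] : List 𝔸) = 0 := rfl

omit [NormedAlgebra 𝕜 𝔸] [CompleteSpace 𝔸] in
/-- `sqSum (b :: l) = b² + sqSum l`. [folklore] -/
@[simp] theorem sqSum_cons (b : 𝔸) (l : List 𝔸) : sqSum (b :: l) = b * b + sqSum l := rfl

omit [NormedAlgebra 𝕜 𝔸] [CompleteSpace 𝔸] in
/-- The ordered pair sum `pairSum [b₁, …, b_n] = Σ_{i<j} b_i b_j` (recursively `pairSum (b :: l) = pairSum l + b · Σ l`)
— the sum `Σ_{b₁≺b₂} A′(b₁)A′(b₂)` of [Balaban1985BackgroundPropagators] (3.2). [folklore] -/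
def pairSum : List 𝔸 → 𝔸
  | [] => 0
  | b :: l => pairSum l + b * l.sum

omit [NormedAlgebra 𝕜 𝔸] [CompleteSpace 𝔸] in
/-- `pairSum [] = 0`. [folklore] -/
@[simp] theorem pairSum_nil : pairSum ([] : List 𝔸) = 0 := rfl

omit [NormedAlgebra 𝕜 𝔸] [CompleteSpace 𝔸] in
/-- `pairSum (b :: l) = pairSum l + b · Σ l`. [folklore] -/
@[simp] theorem pairSum_cons (b : 𝔸) (l : List 𝔸) : pairSum (b :: l) = pairSum l + b * l.sum := rfl

omit [CompleteSpace 𝔸] in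
/-- The bracket printed in [Balaban1985BackgroundPropagators] (3.2): `2 · quad l = Σ_j b_j² + 2 Σ_{i<j} b_i b_j`.
[folklore] -/
theorem two_smul_quad_eq_sqSum_add (l : List 𝔸) : (2 : 𝕜) • quad 𝕜 l = sqSum l + 2 • pairSum l := by
  induction l with
  | nil => simp
  | cons b l ih =>
    rw [quad_cons, sqSum_cons, pairSum_cons, smul_add, smul_add, ih, smul_smul,
      mul_inv_cancel₀ (two_ne_zero' 𝕜), one_smul]
    simp only [two_smul, smul_add]
    abel

omit [NormedAlgebra 𝕜 𝔸] [CompleteSpace 𝔸] in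
/-- The passage (3.2) → (3.6) of [Balaban1985BackgroundPropagators]:
`Σ_j b_j² + 2 Σ_{i<j} b_i b_j = (Σ_j b_j)² + Σ_{i<j} [b_i, b_j]` — so the second-order term of the ordered product is
`½(Σ b_j)² + ½ Σ_{i<j}[b_i, b_j]` (coefficient ONE HALF on the commutator sum; see the module NOTE on (3.6)).
[folklore] -/
theorem sqSum_add_two_smul_pairSum (l : List 𝔸) : sqSum l + 2 • pairSum l = l.sum * l.sum + commSum l := by
  induction l with
  | nil => simp
  | cons b l ih =>
    rw [sqSum_cons, pairSum_cons, List.sum_cons, commSum_cons, smul_add,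
      show b * b + sqSum l + (2 • pairSum l + 2 • (b * l.sum)) =
        (sqSum l + 2 • pairSum l) + (b * b + 2 • (b * l.sum)) by abel,
      ih, two_smul]
    noncomm_ring

omit [CompleteSpace 𝔸] in
/-- The shape of the second-order term in (3.6) of [Balaban1985BackgroundPropagators]:
`2 · quad l = (Σ_j b_j)² + Σ_{i<j} [b_i, b_j]` (half the square of the sum plus half the ordered commutators; the
display (3.6) omits the ½ on the commutator sum — see the module NOTE). [folklore] -/
theorem two_smul_quad (l : List 𝔸) : (2 : 𝕜) • quad 𝕜 l = l.sum * l.sum + commSum l := by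
  induction l with
  | nil => simp
  | cons b l ih =>
    rw [quad_cons, commSum_cons, List.sum_cons, smul_add, smul_add, ih, smul_smul,
      mul_inv_cancel₀ (two_ne_zero' 𝕜), one_smul, two_smul]
    noncomm_ring

omit [CompleteSpace 𝔸] in
/-- `‖quad l‖ ≤ (size l)²/2`. [folklore] -/
theorem norm_quad_le (l : List 𝔸) : ‖quad 𝕜 l‖ ≤ size l ^ 2 / 2 := by
  induction l with
  | nil => simp
  | cons b l ih =>
    rw [quad_cons, size_cons]
    calc ‖quad 𝕜 l + b * l.sum + (2 : 𝕜)⁻¹ • (b * b)‖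
        ≤ ‖quad 𝕜 l‖ + ‖b‖ * ‖l.sum‖ + 2⁻¹ * (‖b‖ * ‖b‖) := by
          refine (norm_add₃_le).trans ?_
          gcongr
          · exact norm_mul_le _ _
          · rw [norm_smul, norm_inv, RCLike.norm_ofNat]
            gcongr
            exact norm_mul_le _ _
      _ ≤ size l ^ 2 / 2 + ‖b‖ * size l + 2⁻¹ * (‖b‖ * ‖b‖) := by
          gcongr
          exact norm_sum_le_size l
      _ = (‖b‖ + size l) ^ 2 / 2 := by ring

omit [NormedAlgebra 𝕜 𝔸] [CompleteSpace 𝔸] in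
/-- `‖commSum l‖ ≤ (size l)²`. [folklore] -/
theorem norm_commSum_le (l : List 𝔸) : ‖commSum l‖ ≤ size l ^ 2 := by
  induction l with
  | nil => simp
  | cons b l ih =>
    rw [commSum_cons, size_cons]
    have hs := norm_sum_le_size l
    have h0 := size_nonneg l
    calc ‖commSum l + (b * l.sum - l.sum * b)‖
        ≤ ‖commSum l‖ + (‖b‖ * ‖l.sum‖ + ‖l.sum‖ * ‖b‖) :=
          (norm_add_le _ _).trans (by
            gcongr
            exact (norm_sub_le _ _).trans (add_le_add (norm_mul_le _ _) (norm_mul_le _ _)))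
      _ ≤ size l ^ 2 + (‖b‖ * size l + size l * ‖b‖) := by gcongr
      _ ≤ (‖b‖ + size l) ^ 2 := by nlinarith [norm_nonneg b]

include 𝕜 in
/-- ZEROTH ORDER: `‖exp b₁ ⋯ exp b_n − 1‖ ≤ e^s − 1`, `s = Σ ‖b_j‖`. [folklore] -/
theorem norm_holonomy_sub_one_le (l : List 𝔸) : ‖holonomy l - 1‖ ≤ expTail 1 (size l) := by
  induction l with
  | nil => simp
  | cons b l ih =>
    rw [holonomy_cons, size_cons, expTail_one_add]
    have h : exp b * holonomy l - 1 = exp b * (holonomy l - 1) + (exp b - 1) := by noncomm_ring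
    rw [h]
    refine (norm_add_le _ _).trans (add_le_add ?_ (norm_exp_sub_one_le_expTail 𝕜 b))
    exact (norm_exp_mul_le 𝕜 b _).trans (mul_le_mul_of_nonneg_left ih (Real.exp_pos _).le)

include 𝕜 in
/-- FIRST ORDER: `‖exp b₁ ⋯ exp b_n − 1 − Σ_j b_j‖ ≤ e^s − 1 − s`, `s = Σ ‖b_j‖` — the linear transport vertex is
`Σ_j b_j` and the remainder is second order in `s`, whatever `n`. [folklore] -/
theorem norm_holonomy_sub_taylor_one_le (l : List 𝔸) :
    ‖holonomy l - 1 - l.sum‖ ≤ expTail 2 (size l) := by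
  induction l with
  | nil => simp
  | cons b l ih =>
    rw [holonomy_cons, size_cons, List.sum_cons, expTail_two_add]
    have h : exp b * holonomy l - 1 - (b + l.sum) =
        exp b * (holonomy l - 1 - l.sum) + (exp b - 1 - b) + (exp b - 1) * l.sum := by noncomm_ring
    rw [h]
    refine (norm_add₃_le).trans (add_le_add_three ?_ (norm_exp_sub_one_sub_le_expTail 𝕜 b) ?_)
    · exact (norm_exp_mul_le 𝕜 b _).trans (mul_le_mul_of_nonneg_left ih (Real.exp_pos _).le)
    · exact (norm_mul_le _ _).trans (by
        gcongr
        · exact expTail_nonneg 1 (norm_nonneg b)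
        · exact norm_exp_sub_one_le_expTail 𝕜 b
        · exact norm_sum_le_size l)

/-- SECOND ORDER: `‖exp b₁ ⋯ exp b_n − 1 − Σ_j b_j − quad l‖ ≤ e^s − 1 − s − s²/2`, `s = Σ ‖b_j‖` — the
quadratic transport vertex is `quad l = ½(Σ b_j)² + ½ Σ_{i<j}[b_i, b_j]` and the remainder is third order in
`s`, whatever `n`. [folklore] -/
theorem norm_holonomy_sub_taylor_two_le (l : List 𝔸) :
    ‖holonomy l - 1 - l.sum - quad 𝕜 l‖ ≤ expTail 3 (size l) := by
  induction l with
  | nil => simp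
  | cons b l ih =>
    rw [holonomy_cons, size_cons, List.sum_cons, quad_cons, expTail_three_add]
    have h : exp b * holonomy l - 1 - (b + l.sum) - (quad 𝕜 l + b * l.sum + (2 : 𝕜)⁻¹ • (b * b)) =
        exp b * (holonomy l - 1 - l.sum - quad 𝕜 l) + (exp b - 1 - b - (2 : 𝕜)⁻¹ • (b * b)) +
          (exp b - 1 - b) * l.sum + (exp b - 1) * quad 𝕜 l := by
      noncomm_ring
    rw [h]
    refine (norm_add_le _ _).trans (add_le_add ((norm_add₃_le).trans (add_le_add_three ?_
      (norm_exp_sub_taylor_two_le 𝕜 b) ?_)) ?_)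
    · exact (norm_exp_mul_le 𝕜 b _).trans (mul_le_mul_of_nonneg_left ih (Real.exp_pos _).le)
    · exact (norm_mul_le _ _).trans (by
        gcongr
        · exact expTail_nonneg 2 (norm_nonneg b)
        · exact norm_exp_sub_one_sub_le_expTail 𝕜 b
        · exact norm_sum_le_size l)
    · exact (norm_mul_le _ _).trans (by
        gcongr
        · exact expTail_nonneg 1 (norm_nonneg b)
        · exact norm_exp_sub_one_le_expTail 𝕜 b
        · exact norm_quad_le 𝕜 l)

/-- The second-order remainder is cubic: `‖holonomy l − 1 − Σ b_j − quad l‖ ≤ (s³/6) e^s`. [folklore] -/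
theorem norm_holonomy_sub_taylor_two_le' (l : List 𝔸) :
    ‖holonomy l - 1 - l.sum - quad 𝕜 l‖ ≤ size l ^ 3 / 6 * Real.exp (size l) :=
  (norm_holonomy_sub_taylor_two_le 𝕜 l).trans (expTail_three_le (size_nonneg l))

end Holonomy

/-! ## §2  Scaling: contours of the `η`-lattice — bounds uniform in the number of bonds -/

section Scaling

variable (𝕜 : Type*) [RCLike 𝕜] {𝔸 : Type*} [NormedRing 𝔸] [NormedAlgebra 𝕜 𝔸] [CompleteSpace 𝔸]

omit [CompleteSpace 𝔸] in
/-- `size (η • l) = ‖η‖ · size l`. [folklore] -/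
theorem size_map_smul (η : 𝕜) (l : List 𝔸) : size (l.map (η • ·)) = ‖η‖ * size l := by
  induction l with
  | nil => simp
  | cons b l ih => simp [ih, norm_smul, mul_add]

omit [CompleteSpace 𝔸] in
/-- `Σ (η • b_j) = η • Σ b_j`. [folklore] -/
theorem sum_map_smul (η : 𝕜) (l : List 𝔸) : (l.map (η • ·)).sum = η • l.sum := by
  induction l with
  | nil => simp
  | cons b l ih => simp [ih, smul_add]

omit [CompleteSpace 𝔸] in
/-- `quad (η • l) = η² • quad l`. [folklore] -/
theorem quad_map_smul (η : 𝕜) (l : List 𝔸) : quad 𝕜 (l.map (η • ·)) = η ^ 2 • quad 𝕜 l := by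
  induction l with
  | nil => simp
  | cons b l ih =>
    rw [List.map_cons, quad_cons, quad_cons, ih, sum_map_smul, smul_add, smul_add, smul_mul_smul_comm,
      smul_mul_smul_comm, pow_two, smul_comm ((2 : 𝕜)⁻¹) (η * η) (b * b)]

omit [CompleteSpace 𝔸] in
/-- `commSum (η • l) = η² • commSum l`. [folklore] -/
theorem commSum_map_smul (η : 𝕜) (l : List 𝔸) : commSum (l.map (η • ·)) = η ^ 2 • commSum l := by
  induction l with
  | nil => simp
  | cons b l ih =>
    rw [List.map_cons, commSum_cons, commSum_cons, ih, sum_map_smul, smul_add, smul_sub,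
      smul_mul_smul_comm, smul_mul_smul_comm, pow_two]

/-- k-UNIFORMITY OF THE TRANSPORT VERTICES.  For a contour of `n` bonds of the `η`-lattice with `‖η‖ · n ≤ ℓ`
(physical length `≤ ℓ`) carrying fields `a_j`, `‖a_j‖ ≤ a`:
`‖Π_j exp(η a_j) − 1 − η Σ_j a_j − η² quad(a)‖ ≤ expTail 3 (ℓ a) = e^{ℓa} − 1 − ℓa − (ℓa)²/2`;
the number of factors `n` (`= O(η⁻¹) = O(L^k)` in the k-th renormalisation step) does not enter. [folklore] -/
theorem norm_holonomy_smul_sub_taylor_two_le (η : 𝕜) (l : List 𝔸) {a ℓ : ℝ} (h0 : 0 ≤ a)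
    (ha : ∀ b ∈ l, ‖b‖ ≤ a) (hℓ : ‖η‖ * l.length ≤ ℓ) :
    ‖holonomy (l.map (η • ·)) - 1 - η • l.sum - η ^ 2 • quad 𝕜 l‖ ≤ expTail 3 (ℓ * a) := by
  have h := norm_holonomy_sub_taylor_two_le 𝕜 (l.map (η • ·))
  rw [sum_map_smul, quad_map_smul, size_map_smul] at h
  refine h.trans (expTail_mono 3 (mul_nonneg (norm_nonneg η) (size_nonneg l)) ?_)
  calc ‖η‖ * size l ≤ ‖η‖ * (l.length * a) := by
        gcongr
        exact size_le_length_mul l ha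
    _ = ‖η‖ * l.length * a := by ring
    _ ≤ ℓ * a := by gcongr

/-- The same with the cubic form of the remainder: `≤ ((ℓa)³/6) e^{ℓa}`. [folklore] -/
theorem norm_holonomy_smul_sub_taylor_two_le' (η : 𝕜) (l : List 𝔸) {a ℓ : ℝ} (h0 : 0 ≤ a)
    (ha : ∀ b ∈ l, ‖b‖ ≤ a) (hℓ : ‖η‖ * l.length ≤ ℓ) :
    ‖holonomy (l.map (η • ·)) - 1 - η • l.sum - η ^ 2 • quad 𝕜 l‖ ≤
      (ℓ * a) ^ 3 / 6 * Real.exp (ℓ * a) := by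
  refine (norm_holonomy_smul_sub_taylor_two_le 𝕜 η l h0 ha hℓ).trans (expTail_three_le ?_)
  have : ‖η‖ * l.length ≤ ℓ := hℓ
  have h1 : 0 ≤ ‖η‖ * l.length := by positivity
  exact mul_nonneg (h1.trans this) h0

/-- FIRST-ORDER version (the linear transport vertex alone): `‖Π_j exp(η a_j) − 1 − η Σ_j a_j‖ ≤ e^{ℓa} − 1 − ℓa
≤ ((ℓa)²/2) e^{ℓa}`. [folklore] -/
theorem norm_holonomy_smul_sub_taylor_one_le (η : 𝕜) (l : List 𝔸) {a ℓ : ℝ} (h0 : 0 ≤ a)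
    (ha : ∀ b ∈ l, ‖b‖ ≤ a) (hℓ : ‖η‖ * l.length ≤ ℓ) :
    ‖holonomy (l.map (η • ·)) - 1 - η • l.sum‖ ≤ (ℓ * a) ^ 2 / 2 * Real.exp (ℓ * a) := by
  have h := norm_holonomy_sub_taylor_one_le 𝕜 (l.map (η • ·))
  rw [sum_map_smul, size_map_smul] at h
  have hs : ‖η‖ * size l ≤ ℓ * a := by
    calc ‖η‖ * size l ≤ ‖η‖ * (l.length * a) := by
          gcongr
          exact size_le_length_mul l ha
      _ = ‖η‖ * l.length * a := by ring
      _ ≤ ℓ * a := by gcongr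
  have h1 : 0 ≤ ‖η‖ * l.length := by positivity
  have hℓa : 0 ≤ ℓ * a := mul_nonneg (h1.trans hℓ) h0
  exact h.trans ((expTail_mono 2 (mul_nonneg (norm_nonneg η) (size_nonneg l)) hs).trans (expTail_two_le hℓa))

omit [CompleteSpace 𝔸] in
/-- Sizes of the vertices themselves: `‖η Σ_j a_j‖ ≤ ℓ a` and `‖η² quad(a)‖ ≤ (ℓa)²/2` under the same
hypotheses — kernels of the first- and second-order transport vertices are bounded by the physical length,
not by the number of bonds. [folklore] -/
theorem norm_transport_vertices_le (η : 𝕜) (l : List 𝔸) {a ℓ : ℝ} (h0 : 0 ≤ a)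
    (ha : ∀ b ∈ l, ‖b‖ ≤ a) (hℓ : ‖η‖ * l.length ≤ ℓ) :
    ‖η • l.sum‖ ≤ ℓ * a ∧ ‖η ^ 2 • quad 𝕜 l‖ ≤ (ℓ * a) ^ 2 / 2 := by
  have hs : ‖η‖ * size l ≤ ℓ * a := by
    calc ‖η‖ * size l ≤ ‖η‖ * (l.length * a) := by
          gcongr
          exact size_le_length_mul l ha
      _ = ‖η‖ * l.length * a := by ring
      _ ≤ ℓ * a := by gcongr
  have h1 : 0 ≤ ‖η‖ * size l := mul_nonneg (norm_nonneg η) (size_nonneg l)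
  refine ⟨?_, ?_⟩
  · rw [norm_smul]
    exact (mul_le_mul_of_nonneg_left (norm_sum_le_size l) (norm_nonneg η)).trans hs
  · rw [norm_smul, norm_pow]
    calc ‖η‖ ^ 2 * ‖quad 𝕜 l‖ ≤ ‖η‖ ^ 2 * (size l ^ 2 / 2) := by
          gcongr
          exact norm_quad_le 𝕜 l
      _ = (‖η‖ * size l) ^ 2 / 2 := by ring
      _ ≤ (ℓ * a) ^ 2 / 2 := by gcongr

end Scaling

/-! ## §3  The vertices as derivatives of the transport path -/

section Calculus

variable (𝕜 : Type*) [RCLike 𝕜] {𝔸 : Type*} [NormedRing 𝔸] [NormedAlgebra 𝕜 𝔸] [CompleteSpace 𝔸]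

/-- The transport path `holPath l t = Π_j exp(t b_j)` (the background switched on with strength `t`). [folklore] -/
def holPath (l : List 𝔸) (t : 𝕜) : 𝔸 := holonomy (l.map (t • ·))

omit [CompleteSpace 𝔸] in
/-- `holPath [] = 1`. [folklore] -/
@[simp] theorem holPath_nil : holPath 𝕜 ([] : List 𝔸) = fun _ => 1 := by
  funext t; simp [holPath]

omit [CompleteSpace 𝔸] in
/-- `holPath (b :: l) t = exp (t b) · holPath l t`. [folklore] -/
theorem holPath_cons (b : 𝔸) (l : List 𝔸) : holPath 𝕜 (b :: l) = fun t => exp (t • b) * holPath 𝕜 l t := by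
  funext t; simp [holPath]

omit [CompleteSpace 𝔸] in
/-- `holPath l 0 = 1`. [folklore] -/
@[simp] theorem holPath_zero (l : List 𝔸) : holPath 𝕜 l 0 = 1 := by
  induction l with
  | nil => simp
  | cons b l ih => simp [holPath_cons, ih]

/-- First derivative of the transport path (recursive Leibniz form):
`D₁ (b :: l) t = b e^{tb} · holPath l t + e^{tb} · D₁ l t`. [folklore] -/
def D₁ : List 𝔸 → 𝕜 → 𝔸
  | [], _ => 0
  | b :: l, t => b * exp (t • b) * holPath 𝕜 l t + exp (t • b) * D₁ l t

/-- Second derivative of the transport path (recursive Leibniz form). [folklore] -/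
def D₂ : List 𝔸 → 𝕜 → 𝔸
  | [], _ => 0
  | b :: l, t => b * (b * exp (t • b)) * holPath 𝕜 l t + 2 • (b * exp (t • b) * D₁ 𝕜 l t) +
      exp (t • b) * D₂ l t

/-- `t ↦ Π_j exp(t b_j)` is differentiable with derivative `D₁ l t`. [folklore] -/
theorem hasDerivAt_holPath (l : List 𝔸) (t : 𝕜) : HasDerivAt (holPath 𝕜 l) (D₁ 𝕜 l t) t := by
  induction l with
  | nil => simpa [D₁] using hasDerivAt_const t (1 : 𝔸)
  | cons b l ih =>
    rw [holPath_cons]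
    have hE : HasDerivAt (fun u : 𝕜 => exp (u • b)) (b * exp (t • b)) t := hasDerivAt_exp_smul_const' b t
    exact (hE.mul ih).congr_deriv (by simp [D₁])

/-- `D₁ l` is differentiable with derivative `D₂ l t`. [folklore] -/
theorem hasDerivAt_D₁ (l : List 𝔸) (t : 𝕜) : HasDerivAt (D₁ 𝕜 l) (D₂ 𝕜 l t) t := by
  induction l with
  | nil =>
    have h : D₁ 𝕜 ([] : List 𝔸) = fun _ => 0 := by funext u; simp [D₁]
    rw [h]
    simpa [D₂] using hasDerivAt_const t (0 : 𝔸)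
  | cons b l ih =>
    have hD : D₁ 𝕜 (b :: l) = fun u => b * exp (u • b) * holPath 𝕜 l u + exp (u • b) * D₁ 𝕜 l u := by
      funext u; simp [D₁]
    rw [hD]
    have hE : HasDerivAt (fun u : 𝕜 => exp (u • b)) (b * exp (t • b)) t := hasDerivAt_exp_smul_const' b t
    have h1 : HasDerivAt (fun u : 𝕜 => b * exp (u • b)) (b * (b * exp (t • b))) t := hE.const_mul b
    have h := (h1.mul (hasDerivAt_holPath 𝕜 l t)).add (hE.mul ih)
    refine h.congr_deriv ?_
    simp only [D₂, two_smul]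
    noncomm_ring

omit [CompleteSpace 𝔸] in
/-- FIRST VARIATION AT ZERO BACKGROUND: `(d/dt)|₀ Π_j exp(t b_j) = Σ_j b_j`. [folklore] -/
@[simp] theorem D₁_zero (l : List 𝔸) : D₁ 𝕜 l 0 = l.sum := by
  induction l with
  | nil => simp [D₁]
  | cons b l ih => simp [D₁, ih]

omit [CompleteSpace 𝔸] in
/-- SECOND VARIATION AT ZERO BACKGROUND: `(d²/dt²)|₀ Π_j exp(t b_j) = (Σ_j b_j)² + Σ_{i<j}[b_i, b_j]`
(twice the second-order term; the shape of [Balaban1985BackgroundPropagators] (3.2)/(3.6)). [folklore] -/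
theorem D₂_zero (l : List 𝔸) : D₂ 𝕜 l 0 = l.sum * l.sum + commSum l := by
  induction l with
  | nil => simp [D₂]
  | cons b l ih =>
    simp only [D₂, zero_smul, exp_zero, holPath_zero, D₁_zero, ih, List.sum_cons, commSum_cons, mul_one,
      one_mul, two_smul]
    noncomm_ring

omit [CompleteSpace 𝔸] in
/-- … equivalently `(d²/dt²)|₀ Π_j exp(t b_j) = 2 · quad l`. [folklore] -/
theorem D₂_zero_eq_two_smul_quad (l : List 𝔸) : D₂ 𝕜 l 0 = (2 : 𝕜) • quad 𝕜 l := by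
  rw [D₂_zero, two_smul_quad]

/-- Summary at zero background: value `1`, first variation `Σ b_j`, second variation `2·quad l`. [folklore] -/
theorem transport_jet_zero (l : List 𝔸) :
    holPath 𝕜 l 0 = 1 ∧ HasDerivAt (holPath 𝕜 l) l.sum 0 ∧ HasDerivAt (D₁ 𝕜 l) ((2 : 𝕜) • quad 𝕜 l) 0 := by
  refine ⟨holPath_zero 𝕜 l, ?_, ?_⟩
  · simpa using hasDerivAt_holPath 𝕜 l 0
  · simpa [D₂_zero_eq_two_smul_quad] using hasDerivAt_D₁ 𝕜 l 0

end Calculus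

/-! ## Examples -/

section Examples

/-- On commuting entries the commutator sum vanishes: two equal bonds. [folklore] -/
example {𝔸 : Type*} [NormedRing 𝔸] (b : 𝔸) : commSum [b, b] = 0 := by
  simp

/-- The second-order term of a two-bond contour: `quad [b₁, b₂] = b₁ b₂ + ½ b₁² + ½ b₂²`. [folklore] -/
example {𝔸 : Type*} [NormedRing 𝔸] [NormedAlgebra ℝ 𝔸] [CompleteSpace 𝔸] (b₁ b₂ : 𝔸) :
    quad ℝ [b₁, b₂] = b₁ * b₂ + (2 : ℝ)⁻¹ • (b₁ * b₁) + (2 : ℝ)⁻¹ • (b₂ * b₂) := by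
  simp only [quad_cons, quad_nil, List.sum_cons, List.sum_nil]
  noncomm_ring

/-- Real numbers, one bond: `holonomy [x] = e^x`. [folklore] -/
example (x : ℝ) : holonomy [x] = Real.exp x := by
  simp [Real.exp_eq_exp_ℝ]

end Examples

end Literature.MathematicalPhysics.QuantumFieldTheory.Balaban1983to89.Beta.TransportVertices
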